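import Summits.CriticalPhenomena.PercolationContinuityZ3.Theorems.PercNearOneGluingNoHeavyQuantSGCLightCellsNoLow
import HarnessLib

/-!
# QUANT lane R8, T-DEC, leg (III): cell TT of `SingleGateConvClosed` from CW on the regime "one of the two triples heavy-low-decomposable
# with the complementary piece free of nonzero lows", and TT from CW + its residual sub-cell

builds on p205010 (kernel theorem, internal audit signed; external expert review pending)

Support file (`--supports stmt-CriticalPhenomena-4575`), QUANT lane, seat prim-quant-arm-3 (gen 121), rung R8 of
`run/shared/lean/prim/quant/LADDER.md`.  Theorems only, standard axioms, no sorries, no definitions.  Companion of `…QuantSGCLightCellsNoLow`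
(the mechanism, PT) and `…QuantSGCLightPairPairHolds` (PP).

For two admissible non-HD triples `μ₁ = {s₁, s₂, s₃; p}` (mean `T₁`), `μ₂ = {r₁, r₂, r₃; w}` (mean `T₂`) the product `gate_q(μ₁ ∗ μ₂)` is DEC at
layer `j′` (target `t = q(T₁ + T₂)`):
* with no hypothesis beyond top-affordability when `j′ < s₁ + r₁` or `t ≤ 2(s₁ + r₁)` (`sgcLightTripleTriple_decAt_of_le`, companion file;
  EXACT CENSUS arm-3 g121 `explore/tt_cover.py`: 29 860 of 34 538 TT layer instances);
* **from CW** when the SECOND triple is in its low case `r₂ ≤ T₂` with HEAVY Lemma-P pair `{r₁, r₃; γ_A}` (`y(r₃ − r₁) ≤ q(T₂ − r₁)`) and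
  `j′ < s₁ + r₂ ∨ t ≤ 2(s₁ + r₂)` (`sgcLightTripleTriple_decAt_of_windowMix_heavyLow_right`: `μ₂ = w_A{r₁,r₃;γ_A} + w_B{r₂,r₃;γ_B}`, the
  heavy piece is CW with `μ₁` as the admissible first factor, the other piece has least atoms `s₁`, `r₂`), or symmetrically for the FIRST
  triple (`…_left`, through `lconv_comm`) — together 4 438 of the 4 678 TT layer instances with a nonzero low (94.9 %);
* **`sgcLightTripleTriple_of_windowMix_of_residual`** — `WindowMixDEC →` (TT on the residual: nonzero low `s₁ + r₁ ≤ j′`, `2(s₁+r₁) < t`, and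
  both one-sided reductions unavailable) `→ SGCLightTripleTriple`.  Residual in the census: 240 / 34 538 layer instances, 0 DEC failures.
HONEST STATUS: TT (residual) / PT (residual) / L2 / L3 / CW / `SingleGateConvClosed` / `GateMove` / `TreeDEC` / `FarTreeRow` remain OPEN;
nothing here is a published result; RATE class log\* / honest sentence unchanged.

[this work]; heavy mix / pieces hook: prim-quant-arm-2 g35; triple bookkeeping and cells: prim-quant-stmt g30/g31 (this lane).  The gluing
rows served [cite: KozmaNitzan2024, Conjecture 3 (p. 15)]; product measure [cite: Grimmett1999, §1.3 p. 10].
-/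

noncomputable section

namespace Summit.CriticalPhenomena.PercolationContinuityZ3.Theorems

namespace Quant

open Finset

/-- two-point law notation `TP[lo, hi, g, h] = g·[h = hi] + (1 − g)·[h = lo]` (as in the lane's other files). -/
local notation3 "TP[" lo ", " hi ", " g ", " h "]" =>
  (g : ℝ) * (if (h : ℕ) = (hi : ℕ) then (1 : ℝ) else 0) + (1 - (g : ℝ)) * (if (h : ℕ) = (lo : ℕ) then (1 : ℝ) else 0)

/-- three-atom law notation `TR[s₁, s₂, s₃, p₁, p₂, p₃, h] = p₁·[h = s₁] + p₂·[h = s₂] + p₃·[h = s₃]`. -/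
local notation3 "TR[" s₁ ", " s₂ ", " s₃ ", " p₁ ", " p₂ ", " p₃ ", " h "]" =>
  (p₁ : ℝ) * (if (h : ℕ) = (s₁ : ℕ) then (1 : ℝ) else 0) + (p₂ : ℝ) * (if (h : ℕ) = (s₂ : ℕ) then (1 : ℝ) else 0)
    + (p₃ : ℝ) * (if (h : ℕ) = (s₃ : ℕ) then (1 : ℝ) else 0)

namespace LawDec

/-- **CW ⟹ TT WHEN THE SECOND TRIPLE HAS `r₂ ≤ T₂`, HEAVY `{r₁, r₃; γ_A}`, AND `s₁ + r₂` IS NOT A LOW.**  First triple admissible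
(positive masses, mean `T₁`, `y·M₁ ≤ q·T₁`, `gate_q μ₁` DEC at every layer `j′ < M₁`), second triple with positive masses, mean `T₂`,
`y·M₂ ≤ q·T₂`; `r₂ ≤ T₂`, `y(r₃ − r₁) ≤ q(T₂ − r₁)`, `j′ < s₁ + r₂ ∨ q(T₁+T₂) ≤ 2(s₁ + r₂)`, `j′ < M₁ + M₂`. [this work] -/
theorem sgcLightTripleTriple_decAt_of_windowMix_heavyLow_right (hCW : WindowMixDEC)
    (y q p₁ p₂ p₃ T₁ w₁ w₂ w₃ T₂ : ℝ) (M₁ M₂ s₁ s₂ s₃ r₁ r₂ r₃ j' : ℕ)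
    (hy0 : 0 < y) (hy1 : y < 1) (hq0 : 0 < q) (hq1 : q ≤ 1)
    (h12 : s₁ < s₂) (h23 : s₂ < s₃) (h3 : s₃ ≤ M₁) (hp₁ : 0 < p₁) (hp₂ : 0 < p₂) (hp₃ : 0 < p₃) (hp : p₁ + p₂ + p₃ = 1)
    (hT₁ : p₁ * (s₁ : ℝ) + p₂ * (s₂ : ℝ) + p₃ * (s₃ : ℝ) = T₁) (hta₁ : y * (M₁ : ℝ) ≤ q * T₁)
    (hD₁ : ∀ j', j' < M₁ → DECAt y j' M₁ (gate (fun h => TR[s₁, s₂, s₃, p₁, p₂, p₃, h]) q))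
    (g12 : r₁ < r₂) (g23 : r₂ < r₃) (g3 : r₃ ≤ M₂) (hw₁ : 0 < w₁) (hw₂ : 0 < w₂) (hw₃ : 0 < w₃) (hw : w₁ + w₂ + w₃ = 1)
    (hT₂ : w₁ * (r₁ : ℝ) + w₂ * (r₂ : ℝ) + w₃ * (r₃ : ℝ) = T₂) (hta₂ : y * (M₂ : ℝ) ≤ q * T₂)
    (hA : (r₂ : ℝ) ≤ T₂) (hheavy : y * ((r₃ : ℝ) - r₁) ≤ q * (T₂ - r₁))
    (hle : j' < s₁ + r₂ ∨ q * (T₁ + T₂) ≤ 2 * ((s₁ : ℝ) + r₂)) (hj : j' < M₁ + M₂) :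
    DECAt y j' (M₁ + M₂)
      (gate (lconv M₁ M₂ (fun h => TR[s₁, s₂, s₃, p₁, p₂, p₃, h]) (fun h => TR[r₁, r₂, r₃, w₁, w₂, w₃, h])) q) := by
  obtain ⟨a0, aM, a1, amean⟩ := triple_laws' p₁ p₂ p₃ T₁ M₁ s₁ s₂ s₃ (by omega) (by omega) h3 hp₁.le hp₂.le hp₃.le hp hT₁
  have hta₁' : y * (M₁ : ℝ) ≤ q * ∑ h ∈ Finset.range (M₁ + 1), (h : ℝ) * TR[s₁, s₂, s₃, p₁, p₂, p₃, h] := by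
    rw [amean]; exact hta₁
  have hr13 : (r₁ : ℝ) < r₃ := by exact_mod_cast g12.trans g23
  have hr23 : (r₂ : ℝ) < r₃ := by exact_mod_cast g23
  have hr12 : (r₁ : ℝ) < r₂ := by exact_mod_cast g12
  have hT3 : T₂ < (r₃ : ℝ) := by
    nlinarith [mul_pos hw₁ (sub_pos.2 hr13), mul_pos hw₂ (sub_pos.2 hr23)]
  have hT1 : (r₁ : ℝ) < T₂ := lt_of_lt_of_le hr12 hA
  have hd₁ : (0 : ℝ) < (r₃ : ℝ) - r₁ := by linarith
  have hd₂ : (0 : ℝ) < (r₃ : ℝ) - r₂ := by linarith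
  have hd₃ : (0 : ℝ) < (r₃ : ℝ) - T₂ := by linarith
  have hd₁' : (r₃ : ℝ) - r₁ ≠ 0 := hd₁.ne'
  have hd₂' : (r₃ : ℝ) - r₂ ≠ 0 := hd₂.ne'
  have hd₃' : (r₃ : ℝ) - T₂ ≠ 0 := hd₃.ne'
  obtain ⟨γA, hγA⟩ : ∃ g : ℝ, g = (T₂ - r₁) / ((r₃ : ℝ) - r₁) := ⟨_, rfl⟩
  obtain ⟨γB, hγB⟩ : ∃ g : ℝ, g = (T₂ - r₂) / ((r₃ : ℝ) - r₂) := ⟨_, rfl⟩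
  obtain ⟨wA, hwA⟩ : ∃ v : ℝ, v = w₁ * ((r₃ : ℝ) - r₁) / ((r₃ : ℝ) - T₂) := ⟨_, rfl⟩
  obtain ⟨wB, hwB⟩ : ∃ v : ℝ, v = w₂ * ((r₃ : ℝ) - r₂) / ((r₃ : ℝ) - T₂) := ⟨_, rfl⟩
  have hγA0 : 0 ≤ γA := by rw [hγA]; exact div_nonneg (by linarith) hd₁.le
  have hγA1 : γA ≤ 1 := by rw [hγA, div_le_one hd₁]; linarith
  have hγB0 : 0 ≤ γB := by rw [hγB]; exact div_nonneg (by linarith) hd₂.le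
  have hγB1 : γB ≤ 1 := by rw [hγB, div_le_one hd₂]; linarith
  have hmeanA : (r₁ : ℝ) + ((r₃ : ℝ) - r₁) * γA = T₂ := by rw [hγA]; field_simp; ring
  have hmeanB : (r₂ : ℝ) + ((r₃ : ℝ) - r₂) * γB = T₂ := by rw [hγB]; field_simp; ring
  have hwA0 : 0 ≤ wA := by rw [hwA]; exact div_nonneg (mul_nonneg hw₁.le hd₁.le) hd₃.le
  have hwB0 : 0 ≤ wB := by rw [hwB]; exact div_nonneg (mul_nonneg hw₂.le hd₂.le) hd₃.le
  have hw1 : wA + wB = 1 := by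
    have hnum : w₁ * ((r₃ : ℝ) - r₁) + w₂ * ((r₃ : ℝ) - r₂) = (r₃ : ℝ) - T₂ := by
      linear_combination (r₃ : ℝ) * hw - hT₂
    rw [hwA, hwB, ← add_div, hnum, div_self hd₃']
  have hheavyA : y ≤ q * γA := by
    rw [hγA, mul_div_assoc', le_div_iff₀ hd₁]; linarith
  -- decomposition of the second triple over `Bool`
  have hv0 : ∀ b : Bool, 0 ≤ cond b wA wB := fun b => by cases b; exacts [hwB0, hwA0]
  have hv1 : ∑ b : Bool, cond b wA wB = 1 := by rw [Fintype.sum_bool]; exact hw1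
  have hμ₂ : ∀ h, TR[r₁, r₂, r₃, w₁, w₂, w₃, h] =
      ∑ b : Bool, cond b wA wB * cond b (TP[r₁, r₃, γA, h]) (TP[r₂, r₃, γB, h]) := by
    intro h
    rw [Fintype.sum_bool]
    show _ = wA * TP[r₁, r₃, γA, h] + wB * TP[r₂, r₃, γB, h]
    rw [hwA, hwB, hγA, hγB]
    exact triple_eq_twoPairs_low w₁ w₂ w₃ T₂ r₁ r₂ r₃ g12 g23 hw hT₂ hT3 h
  obtain ⟨-, -, b1, bmean⟩ := triple_laws' w₁ w₂ w₃ T₂ M₂ r₁ r₂ r₃ (by omega) (by omega) g3 hw₁.le hw₂.le hw₃.le hw hT₂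
  have hmeanP : ∑ h ∈ Finset.range (M₁ + M₂ + 1),
      (h : ℝ) * gate (lconv M₁ M₂ (fun h => TR[s₁, s₂, s₃, p₁, p₂, p₃, h]) (fun h => TR[r₁, r₂, r₃, w₁, w₂, w₃, h])) q h
        = q * (T₁ + T₂) := by
    rw [sum_mul_gate, sum_mul_lconv M₁ M₂ _ _ a1 b1, amean, bmean]
  rw [decAt_iff_decAtT, hmeanP]
  refine decAtT_gate_lconv_of_pieces_right y (q * (T₁ + T₂)) q j' (M₁ + M₂) M₁ M₂ _ _ (fun b => cond b wA wB)
    (fun b h => cond b (TP[r₁, r₃, γA, h]) (TP[r₂, r₃, γB, h])) hv0 hv1 hμ₂ fun b _ => ?_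
  cases b with
  | true =>
    show DECAtT y (q * (T₁ + T₂)) j' (M₁ + M₂)
      (gate (lconv M₁ M₂ (fun h => TR[s₁, s₂, s₃, p₁, p₂, p₃, h]) (fun h => TP[r₁, r₃, γA, h])) q)
    have h := singleGateConvClosed_heavyMix_of_windowMix hCW y q T₂ M₁ M₂ (fun h => TR[s₁, s₂, s₃, p₁, p₂, p₃, h]) (ι := Unit)
      (fun _ => (1 : ℝ)) (fun _ => γA) (fun _ => r₁) (fun _ => r₃) hy0 hy1 hq0 hq1 a0 aM a1 hta₁' hD₁
      (fun _ => zero_le_one) (by simp) (fun _ => hγA1) (fun _ => hheavyA) (fun _ => (g12.trans g23).le) (fun _ => g3)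
      (fun _ => hmeanA) j' hj
    have e : (fun h => ∑ _i : Unit, (1 : ℝ) * TP[r₁, r₃, γA, h]) = fun h => TP[r₁, r₃, γA, h] := by
      funext h; simp only [Finset.univ_unique, Finset.sum_singleton, one_mul]
    rw [e, decAt_iff_decAtT] at h
    obtain ⟨-, -, c1, cmean⟩ := tp_laws M₂ r₁ r₃ γA hγA0 hγA1 (g12.trans g23).le g3
    rw [sum_mul_gate, sum_mul_lconv M₁ M₂ _ _ a1 c1, amean, cmean, hmeanA] at h
    exact h
  | false =>
    show DECAtT y (q * (T₁ + T₂)) j' (M₁ + M₂)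
      (gate (lconv M₁ M₂ (fun h => TR[s₁, s₂, s₃, p₁, p₂, p₃, h]) (fun h => TP[r₂, r₃, γB, h])) q)
    obtain ⟨c0, -, c1, cmean⟩ := tp_laws M₂ r₂ r₃ γB hγB0 hγB1 g23.le g3
    rw [hmeanB] at cmean
    have hM₁ : (1 : ℝ) ≤ M₁ := by
      exact_mod_cast (Nat.succ_le_of_lt (Nat.lt_of_le_of_lt (Nat.zero_le s₂) (Nat.lt_of_lt_of_le h23 h3)))
    have hT₂0 : 0 ≤ T₂ := le_of_lt (lt_of_le_of_lt (Nat.cast_nonneg r₁) hT1)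
    have htpos : 0 < q * (T₁ + T₂) := by
      have h1 : 0 < y * (M₁ : ℝ) := mul_pos hy0 (by linarith)
      rw [mul_add]; exact add_pos_of_pos_of_nonneg (lt_of_lt_of_le h1 hta₁) (mul_nonneg hq0.le hT₂0)
    have hta : y * ((M₁ : ℝ) + M₂) ≤ q * (T₁ + T₂) := by rw [mul_add, mul_add]; exact add_le_add hta₁ hta₂
    have h := gate_lconv_decAt_of_minAtoms y q T₁ T₂ M₁ M₂ s₁ r₂ j' (fun h => TR[s₁, s₂, s₃, p₁, p₂, p₃, h])
      (fun h => TP[r₂, r₃, γB, h]) hy0 hy1 hq0.le hq1 a0 a1 amean c0 c1 cmean htpos hta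
      (fun i hi => tr_minAtom s₁ s₂ s₃ p₁ p₂ p₃ h12 h23 i hi) (fun k hk => tp_minAtom r₂ r₃ γB g23.le k hk) hle
    rw [decAt_iff_decAtT, sum_mul_gate, sum_mul_lconv M₁ M₂ _ _ a1 c1, amean, cmean] at h
    exact h

/-- **THE SAME WITH THE FIRST TRIPLE DECOMPOSED** (`s₂ ≤ T₁`, `{s₁, s₃}` heavy, `s₂ + r₁` not a low; the second triple the admissible
factor), through `lconv_comm`. [this work] -/
theorem sgcLightTripleTriple_decAt_of_windowMix_heavyLow_left (hCW : WindowMixDEC)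
    (y q p₁ p₂ p₃ T₁ w₁ w₂ w₃ T₂ : ℝ) (M₁ M₂ s₁ s₂ s₃ r₁ r₂ r₃ j' : ℕ)
    (hy0 : 0 < y) (hy1 : y < 1) (hq0 : 0 < q) (hq1 : q ≤ 1)
    (h12 : s₁ < s₂) (h23 : s₂ < s₃) (h3 : s₃ ≤ M₁) (hp₁ : 0 < p₁) (hp₂ : 0 < p₂) (hp₃ : 0 < p₃) (hp : p₁ + p₂ + p₃ = 1)
    (hT₁ : p₁ * (s₁ : ℝ) + p₂ * (s₂ : ℝ) + p₃ * (s₃ : ℝ) = T₁) (hta₁ : y * (M₁ : ℝ) ≤ q * T₁)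
    (g12 : r₁ < r₂) (g23 : r₂ < r₃) (g3 : r₃ ≤ M₂) (hw₁ : 0 < w₁) (hw₂ : 0 < w₂) (hw₃ : 0 < w₃) (hw : w₁ + w₂ + w₃ = 1)
    (hT₂ : w₁ * (r₁ : ℝ) + w₂ * (r₂ : ℝ) + w₃ * (r₃ : ℝ) = T₂) (hta₂ : y * (M₂ : ℝ) ≤ q * T₂)
    (hD₂ : ∀ j', j' < M₂ → DECAt y j' M₂ (gate (fun h => TR[r₁, r₂, r₃, w₁, w₂, w₃, h]) q))
    (hA : (s₂ : ℝ) ≤ T₁) (hheavy : y * ((s₃ : ℝ) - s₁) ≤ q * (T₁ - s₁))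
    (hle : j' < s₂ + r₁ ∨ q * (T₁ + T₂) ≤ 2 * ((s₂ : ℝ) + r₁)) (hj : j' < M₁ + M₂) :
    DECAt y j' (M₁ + M₂)
      (gate (lconv M₁ M₂ (fun h => TR[s₁, s₂, s₃, p₁, p₂, p₃, h]) (fun h => TR[r₁, r₂, r₃, w₁, w₂, w₃, h])) q) := by
  have hle' : j' < r₁ + s₂ ∨ q * (T₂ + T₁) ≤ 2 * ((r₁ : ℝ) + s₂) := by
    rcases hle with h | h
    · exact Or.inl (by omega)
    · exact Or.inr (by linarith)
  have h := sgcLightTripleTriple_decAt_of_windowMix_heavyLow_right hCW y q w₁ w₂ w₃ T₂ p₁ p₂ p₃ T₁ M₂ M₁ r₁ r₂ r₃ s₁ s₂ s₃ j'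
    hy0 hy1 hq0 hq1 g12 g23 g3 hw₁ hw₂ hw₃ hw hT₂ hta₂ hD₂ h12 h23 h3 hp₁ hp₂ hp₃ hp hT₁ hta₁ hA hheavy hle' (by omega)
  rw [lconv_comm, Nat.add_comm]; exact h

/-- **CELL TT ⟸ CW + ITS RESIDUAL SUB-CELL.**  The residual is TT's binder restricted to the layers / parameters with a nonzero low
(`s₁ + r₁ ≤ j′`, `2(s₁ + r₁) < t`) where NEITHER one-sided reduction applies (for the second triple: `T₂ < r₂`, or `{r₁, r₃}` light, or
`s₁ + r₂` a low; and for the first: `T₁ < s₂`, or `{s₁, s₃}` light, or `s₂ + r₁` a low).  EXACT CENSUS (arm-3 g121 `explore/tt_cover.py`):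
240 of 34 538 TT layer instances, 0 DEC failures. [this work] -/
theorem sgcLightTripleTriple_of_windowMix_of_residual (hCW : WindowMixDEC)
    (hR : ∀ (y q p₁ p₂ p₃ T₁ w₁ w₂ w₃ T₂ : ℝ) (M₁ M₂ s₁ s₂ s₃ r₁ r₂ r₃ : ℕ),
      0 < y → y < 1 → 0 < q → q ≤ 1 →
      s₁ < s₂ → s₂ < s₃ → s₃ ≤ M₁ → 0 < p₁ → 0 < p₂ → 0 < p₃ → p₁ + p₂ + p₃ = 1 →
      p₁ * (s₁ : ℝ) + p₂ * (s₂ : ℝ) + p₃ * (s₃ : ℝ) = T₁ →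
      y * (M₁ : ℝ) ≤ q * T₁ →
      ((s₂ : ℝ) ≤ T₁ ∧ q * (T₁ - s₂) < y * ((s₃ : ℝ) - s₂) ∨ T₁ < (s₂ : ℝ) ∧ q * (T₁ - s₁) < y * ((s₃ : ℝ) - s₁)) →
      (∀ j', j' < M₁ → DECAt y j' M₁ (gate (fun h => TR[s₁, s₂, s₃, p₁, p₂, p₃, h]) q)) →
      r₁ < r₂ → r₂ < r₃ → r₃ ≤ M₂ → 0 < w₁ → 0 < w₂ → 0 < w₃ → w₁ + w₂ + w₃ = 1 →
      w₁ * (r₁ : ℝ) + w₂ * (r₂ : ℝ) + w₃ * (r₃ : ℝ) = T₂ →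
      y * (M₂ : ℝ) ≤ q * T₂ →
      ((r₂ : ℝ) ≤ T₂ ∧ q * (T₂ - r₂) < y * ((r₃ : ℝ) - r₂) ∨ T₂ < (r₂ : ℝ) ∧ q * (T₂ - r₁) < y * ((r₃ : ℝ) - r₁)) →
      (∀ j', j' < M₂ → DECAt y j' M₂ (gate (fun h => TR[r₁, r₂, r₃, w₁, w₂, w₃, h]) q)) →
      ∀ j', j' < M₁ + M₂ → s₁ + r₁ ≤ j' → 2 * ((s₁ : ℝ) + r₁) < q * (T₁ + T₂) →
        (T₂ < (r₂ : ℝ) ∨ q * (T₂ - r₁) < y * ((r₃ : ℝ) - r₁) ∨ (s₁ + r₂ ≤ j' ∧ 2 * ((s₁ : ℝ) + r₂) < q * (T₁ + T₂))) →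
        (T₁ < (s₂ : ℝ) ∨ q * (T₁ - s₁) < y * ((s₃ : ℝ) - s₁) ∨ (s₂ + r₁ ≤ j' ∧ 2 * ((s₂ : ℝ) + r₁) < q * (T₁ + T₂))) →
        DECAt y j' (M₁ + M₂)
          (gate (lconv M₁ M₂ (fun h => TR[s₁, s₂, s₃, p₁, p₂, p₃, h]) (fun h => TR[r₁, r₂, r₃, w₁, w₂, w₃, h])) q)) :
    SGCLightTripleTriple := by
  intro y q p₁ p₂ p₃ T₁ w₁ w₂ w₃ T₂ M₁ M₂ s₁ s₂ s₃ r₁ r₂ r₃ hy0 hy1 hq0 hq1 h12 h23 h3 hp₁ hp₂ hp₃ hp hT₁ hta₁ hnotHD₁ hD₁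
    g12 g23 g3 hw₁ hw₂ hw₃ hw hT₂ hta₂ hnotHD₂ hD₂ j' hj'
  by_cases h1 : j' < s₁ + r₁ ∨ q * (T₁ + T₂) ≤ 2 * ((s₁ : ℝ) + r₁)
  · exact sgcLightTripleTriple_decAt_of_le y q p₁ p₂ p₃ T₁ w₁ w₂ w₃ T₂ M₁ M₂ s₁ s₂ s₃ r₁ r₂ r₃ j' hy0 hy1 hq0 hq1 h12 h23 h3
      hp₁.le hp₂.le hp₃.le hp hT₁ hta₁ g12 g23 g3 hw₁.le hw₂.le hw₃.le hw hT₂ hta₂ h1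
  have hj1 : s₁ + r₁ ≤ j' := by
    by_contra hc
    exact h1 (Or.inl (by omega))
  have ht1 : 2 * ((s₁ : ℝ) + r₁) < q * (T₁ + T₂) := by
    by_contra hc
    exact h1 (Or.inr (not_lt.1 hc))
  have hR' := hR y q p₁ p₂ p₃ T₁ w₁ w₂ w₃ T₂ M₁ M₂ s₁ s₂ s₃ r₁ r₂ r₃ hy0 hy1 hq0 hq1 h12 h23 h3 hp₁ hp₂ hp₃ hp hT₁ hta₁ hnotHD₁
    hD₁ g12 g23 g3 hw₁ hw₂ hw₃ hw hT₂ hta₂ hnotHD₂ hD₂ j' hj' hj1 ht1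
  -- the one-sided reduction on the FIRST triple, given the residual implication for it
  have firstSide : ((T₁ < (s₂ : ℝ) ∨ q * (T₁ - s₁) < y * ((s₃ : ℝ) - s₁) ∨
      (s₂ + r₁ ≤ j' ∧ 2 * ((s₂ : ℝ) + r₁) < q * (T₁ + T₂))) →
      DECAt y j' (M₁ + M₂)
        (gate (lconv M₁ M₂ (fun h => TR[s₁, s₂, s₃, p₁, p₂, p₃, h]) (fun h => TR[r₁, r₂, r₃, w₁, w₂, w₃, h])) q)) →
      DECAt y j' (M₁ + M₂)
        (gate (lconv M₁ M₂ (fun h => TR[s₁, s₂, s₃, p₁, p₂, p₃, h]) (fun h => TR[r₁, r₂, r₃, w₁, w₂, w₃, h])) q) := by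
    intro hk
    by_cases hA1 : (s₂ : ℝ) ≤ T₁
    · by_cases hH1 : y * ((s₃ : ℝ) - s₁) ≤ q * (T₁ - s₁)
      · by_cases h3' : j' < s₂ + r₁ ∨ q * (T₁ + T₂) ≤ 2 * ((s₂ : ℝ) + r₁)
        · exact sgcLightTripleTriple_decAt_of_windowMix_heavyLow_left hCW y q p₁ p₂ p₃ T₁ w₁ w₂ w₃ T₂ M₁ M₂ s₁ s₂ s₃ r₁ r₂ r₃
            j' hy0 hy1 hq0 hq1 h12 h23 h3 hp₁ hp₂ hp₃ hp hT₁ hta₁ g12 g23 g3 hw₁ hw₂ hw₃ hw hT₂ hta₂ hD₂ hA1 hH1 h3' hj'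
        · have hj3 : s₂ + r₁ ≤ j' := by
            by_contra hc
            exact h3' (Or.inl (by omega))
          have ht3 : 2 * ((s₂ : ℝ) + r₁) < q * (T₁ + T₂) := by
            by_contra hc
            exact h3' (Or.inr (not_lt.1 hc))
          exact hk (Or.inr (Or.inr ⟨hj3, ht3⟩))
      · exact hk (Or.inr (Or.inl (not_le.1 hH1)))
    · exact hk (Or.inl (not_le.1 hA1))
  -- the one-sided reduction on the SECOND triple, else hand over to `firstSide`
  by_cases hA : (r₂ : ℝ) ≤ T₂
  · by_cases hH : y * ((r₃ : ℝ) - r₁) ≤ q * (T₂ - r₁)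
    · by_cases h2 : j' < s₁ + r₂ ∨ q * (T₁ + T₂) ≤ 2 * ((s₁ : ℝ) + r₂)
      · exact sgcLightTripleTriple_decAt_of_windowMix_heavyLow_right hCW y q p₁ p₂ p₃ T₁ w₁ w₂ w₃ T₂ M₁ M₂ s₁ s₂ s₃ r₁ r₂ r₃ j'
          hy0 hy1 hq0 hq1 h12 h23 h3 hp₁ hp₂ hp₃ hp hT₁ hta₁ hD₁ g12 g23 g3 hw₁ hw₂ hw₃ hw hT₂ hta₂ hA hH h2 hj'
      · have hj2 : s₁ + r₂ ≤ j' := by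
          by_contra hc
          exact h2 (Or.inl (by omega))
        have ht2 : 2 * ((s₁ : ℝ) + r₂) < q * (T₁ + T₂) := by
          by_contra hc
          exact h2 (Or.inr (not_lt.1 hc))
        exact firstSide (hR' (Or.inr (Or.inr ⟨hj2, ht2⟩)))
    · exact firstSide (hR' (Or.inr (Or.inl (not_le.1 hH))))
  · exact firstSide (hR' (Or.inl (not_le.1 hA)))

end LawDec

end Quant

end Summit.CriticalPhenomena.PercolationContinuityZ3.Theorems
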